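import Summits.QuantumFields.YangMills.Theses.GradientFlowWitness
import HarnessLib

/-!
# Route `GradientFlowWitness` (rev 1): the assembly item stmt-QuantumFields-25686

`Assembly := FlowedResponseFloor → FlowedMirrorCeiling → MirrorDefectVanishes → SkewnessResidual → BalabanLadder.NT`
is, up to the order of its hypotheses, the type of the route's deciding theorem `GradientFlowWitness.closes`
(planner ym-idea-7, rev 1; kernel-checked glue: Gram-form RP–CS `NT.Reflection.sq_cov_negReflect_le_odd_pos`, the
shared defect item at femto radius `ℓ₃`, the declared residual for clause (ii)).  This file closes the assembly
item by that theorem.  It proves an IMPLICATION only: none of the four hypotheses (items 25684, 25685, 25440, 25278)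
is proved, and neither `BalabanLadder.NT` nor the Yang–Mills mass gap is proved or claimed here.
-/

set_option autoImplicit false

namespace Summit.QuantumFields.YangMills.Theses.GradientFlowWitness

/-- **The assembly item of route `GradientFlowWitness`** (stmt-QuantumFields-25686):
`FlowedResponseFloor → FlowedMirrorCeiling → MirrorDefectVanishes → SkewnessResidual → BalabanLadder.NT`, by the
route's kernel-checked deciding theorem `closes` (an implication; no hypothesis is discharged). -/
theorem assembly_proof : Summit.QuantumFields.YangMills.Theses.GradientFlowWitness.Assembly :=
  fun h₁ h₂ h₄ h₃ => closes h₁ h₂ h₄ h₃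

end Summit.QuantumFields.YangMills.Theses.GradientFlowWitness
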